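import Summits.CriticalPhenomena.CardyFormulaZ2.Theses.CardyBoundaryCoulombGas

/-!
# The mark-density member of `BoundaryDefectGaussianR` (helper for `DensityIntegration`,
# item stmt-CriticalPhenomena-14890, route CardyBoundaryCoulombGas)

The glue `DensityIntegration : BoundaryDefectGaussianR → RectilinearCardy` uses exactly one member
of the engine crux: `k = 4`, legs `L = (1,1,1,3)`, sink `j = 3`, charges `e = (1,1,1,-2)`.
This file performs that specialisation once and for all, with the Coulomb-gas bookkeeping done
in Lean: the lattice normalisation is `δ^{-Σ h(e_i)} = δ^{-1}` (`h(1) = 0`, `h(-2) = 1`), the pair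
exponents are `1/3` among the three sources and `-2/3` source–sink, and the only derivative
factor is `‖w′(x)‖¹` at the sink. The insertion datum is rewritten in the canonical form
`⟨{a, b, c}, 𝟙_{{a,b,c}}, x⟩`.
-/

noncomputable section

open Filter Topology

namespace Summit.CriticalPhenomena.CardyFormulaZ2.Theorems

open Literature.Probability.RandomPlanarGeometry Literature.Probability.LatticeModels
open Summit.CriticalPhenomena.CardyFormulaZ2.Theses.CardyBoundaryCoulombGas

/-- The Coulomb-gas bookkeeping of the `(1,1,1;3)` member: with `L = (1,1,1,3)`, sink `j = 3`,
charges `e_i = L_i` at the sources and `e_3 = 1 - L_3 = -2` at the sink, the lattice normalisation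
exponent is `Σ_i e_i(e_i-1)/6 = 1`, the pair exponents `e_ie_{i'}/3` are `1/3` (source–source) and
`-2/3` (source–sink), and the derivative weights `h(e_i)` are `0, 0, 0, 1`. [folklore] -/
theorem markDensity_bookkeeping (C δ : ℝ) (z : Fin 4 → ℂ) (d : Fin 4 → ℂ) :
    δ ^ (-∑ i : Fin 4, (if i = 3 then 1 - ((![1, 1, 1, 3] : Fin 4 → ℕ) 3 : ℝ)
        else ((![1, 1, 1, 3] : Fin 4 → ℕ) i : ℝ)) *
        ((if i = 3 then 1 - ((![1, 1, 1, 3] : Fin 4 → ℕ) 3 : ℝ)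
          else ((![1, 1, 1, 3] : Fin 4 → ℕ) i : ℝ)) - 1) / 6) = δ⁻¹ ∧
    ((C * ∏ i : Fin 4, ∏ i' ∈ Finset.univ.filter (fun i' ↦ i < i'),
        ‖z i - z i'‖ ^
          (((if i = 3 then 1 - ((![1, 1, 1, 3] : Fin 4 → ℕ) 3 : ℝ)
              else ((![1, 1, 1, 3] : Fin 4 → ℕ) i : ℝ)) *
              if i' = 3 then 1 - ((![1, 1, 1, 3] : Fin 4 → ℕ) 3 : ℝ)
              else ((![1, 1, 1, 3] : Fin 4 → ℕ) i' : ℝ)) / 3)) *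
      ∏ i : Fin 4, ‖d i‖ ^
        ((if i = 3 then 1 - ((![1, 1, 1, 3] : Fin 4 → ℕ) 3 : ℝ)
          else ((![1, 1, 1, 3] : Fin 4 → ℕ) i : ℝ)) *
          ((if i = 3 then 1 - ((![1, 1, 1, 3] : Fin 4 → ℕ) 3 : ℝ)
            else ((![1, 1, 1, 3] : Fin 4 → ℕ) i : ℝ)) - 1) / 6))
      = C * ((‖z 0 - z 1‖ * ‖z 0 - z 2‖ * ‖z 1 - z 2‖) ^ (1 / 3 : ℝ) *
          (‖z 0 - z 3‖ * ‖z 1 - z 3‖ * ‖z 2 - z 3‖) ^ (-(2 / 3) : ℝ)) * ‖d 3‖ := by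
  have e3 : ((![1, 1, 1, 3] : Fin 4 → ℕ) 3 : ℝ) = 3 := by
    rw [show ((![1, 1, 1, 3] : Fin 4 → ℕ) 3) = 3 from rfl]; norm_num
  have e2 : ((![1, 1, 1, 3] : Fin 4 → ℕ) 2 : ℝ) = 1 := by
    rw [show ((![1, 1, 1, 3] : Fin 4 → ℕ) 2) = 1 from rfl]; norm_num
  have e1 : ((![1, 1, 1, 3] : Fin 4 → ℕ) 1 : ℝ) = 1 := by
    rw [show ((![1, 1, 1, 3] : Fin 4 → ℕ) 1) = 1 from rfl]; norm_num
  have e0 : ((![1, 1, 1, 3] : Fin 4 → ℕ) 0 : ℝ) = 1 := by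
    rw [show ((![1, 1, 1, 3] : Fin 4 → ℕ) 0) = 1 from rfl]; norm_num
  constructor
  · simp +decide only [Fin.sum_univ_four, e3, e2, e1, e0, Fin.isValue, if_true, if_false]
    norm_num
    exact Real.rpow_neg_one δ
  · have hprod : ‖z 0 - z 1‖ ^ (1 / 3 : ℝ) * ‖z 0 - z 2‖ ^ (1 / 3 : ℝ) * ‖z 0 - z 3‖ ^ (-(2 / 3) : ℝ) *
          (‖z 1 - z 2‖ ^ (1 / 3 : ℝ) * ‖z 1 - z 3‖ ^ (-(2 / 3) : ℝ)) * ‖z 2 - z 3‖ ^ (-(2 / 3) : ℝ) =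
        (‖z 0 - z 1‖ * ‖z 0 - z 2‖ * ‖z 1 - z 2‖) ^ (1 / 3 : ℝ) *
          (‖z 0 - z 3‖ * ‖z 1 - z 3‖ * ‖z 2 - z 3‖) ^ (-(2 / 3) : ℝ) := by
      rw [Real.mul_rpow (by positivity) (by positivity), Real.mul_rpow (by positivity) (by positivity),
        Real.mul_rpow (by positivity) (by positivity), Real.mul_rpow (by positivity) (by positivity)]
      ring
    simp +decide only [Finset.prod_filter, Fin.prod_univ_four, e3, e2, e1, e0, if_true, if_false]
    norm_num
    rw [← hprod]
    exact Or.inl (Or.inl rfl)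

/-- The insertion datum of the `(1,1,1;3)` member in canonical form: sources `{a, b, c}` with one
leg each (leg function the indicator of `{a, b, c}`), sink `x`. [folklore] -/
theorem insertionData_oneOneOneThree {q : Fin 4 → ℤ × ℤ} (hq : Function.Injective q) :
    (⟨Finset.image q (Finset.univ.erase 3),
        fun v ↦ ∑ i ∈ (Finset.univ.erase 3).filter (fun i ↦ q i = v), (![1, 1, 1, 3] : Fin 4 → ℕ) i,
        q 3⟩ : CollarLegModel.LegInsertionData) =
      ⟨{q 0, q 1, q 2}, fun v ↦ if v = q 0 ∨ v = q 1 ∨ v = q 2 then 1 else 0, q 3⟩ := by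
  have hs : (Finset.univ.erase (3 : Fin 4)) = {0, 1, 2} := by decide
  have e2 : ((![1, 1, 1, 3] : Fin 4 → ℕ) 2) = 1 := rfl
  have e1 : ((![1, 1, 1, 3] : Fin 4 → ℕ) 1) = 1 := rfl
  have e0 : ((![1, 1, 1, 3] : Fin 4 → ℕ) 0) = 1 := rfl
  have h01 : q 0 ≠ q 1 := fun h ↦ by simpa using hq h
  have h02 : q 0 ≠ q 2 := fun h ↦ by simpa using hq h
  have h12 : q 1 ≠ q 2 := fun h ↦ by simpa using hq h
  rw [hs]
  congr 1
  · simp [Finset.image_insert]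
  · funext v
    rw [Finset.sum_filter, Finset.sum_insert (by simp), Finset.sum_insert (by simp),
      Finset.sum_singleton, e0, e1, e2]
    by_cases h0 : v = q 0
    · subst h0; simp [Ne.symm h01, Ne.symm h02]
    · by_cases h1 : v = q 1
      · subst h1; simp [h01, Ne.symm h12]
      · by_cases h2 : v = q 2
        · subst h2; simp [h02, h12]
        · simp [h0, h1, h2, Ne.symm h0, Ne.symm h1, Ne.symm h2]

/-- **The mark-density member of the engine crux.** `BoundaryDefectGaussianR` specialised to
`k = 4`, `L = (1,1,1,3)`, sink `j = 3`: for every rectilinear marked domain `(D; a, b, c, x)` flat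
near its marks, every conformal map `w : D → ℍ` analytic near the marks with `Re (w ∘ ∂D)`
increasing at the marks, every mesh sequence `δ_n → 0⁺` with `V_n = D̄ ∩ δ_n ℤ²` and admissible
lattice marks `p_n → (a, b, c, x)`, the normalised rainbow partition function satisfies
`δ_n⁻¹ ‖Zins V_n ⟨{a_n,b_n,c_n}, 1, x_n⟩‖ / ‖Z V_n‖ →
C · (|w_a-w_b||w_a-w_c||w_b-w_c|)^{1/3} (|w_a-w_x||w_b-w_x||w_c-w_x|)^{-2/3} |w′(x)|`
with the crux's universal constant `C > 0` (to be pinned to `cardyConst/3` by total mass).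
This is the density `F'(η) ∂ₓη` of Cardy's formula in the moving mark (Cardy 1992;
Dubédat 2005 §4), the only member of the crux that `DensityIntegration` consumes. [folklore] -/
theorem markDensity_of_boundaryDefectGaussianR (h : BoundaryDefectGaussianR) :
    ∃ C : ℝ, 0 < C ∧ ∀ (D : MarkedDomain 4),
      (∃ S : Finset (ℂ × ℂ), (∀ q ∈ S, q.1.re = q.2.re ∨ q.1.im = q.2.im) ∧
        frontier D.carrier ⊆ ⋃ q ∈ S, segment ℝ q.1 q.2) →
      (∀ i, ∃ r : ℝ, 0 < r ∧
        ((∀ z ∈ frontier D.carrier, dist z (D.pt i) < r → z.im = (D.pt i).im) ∨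
          (∀ z ∈ frontier D.carrier, dist z (D.pt i) < r → z.re = (D.pt i).re))) →
      ∀ (w : ℂ → ℂ) (U : Set ℂ), IsOpen U → D.carrier ⊆ U → (∀ i, D.pt i ∈ U) →
        DifferentiableOn ℂ w U → Set.BijOn w D.carrier {z : ℂ | 0 < z.im} →
        (∀ i, ∃ ε : ℝ, 0 < ε ∧ StrictMonoOn (fun t : ℝ ↦ (w (D.boundary t)).re)
          (Set.Ioo (D.mark i - ε) (D.mark i + ε))) →
      ∀ (δ : ℕ → ℝ), (∀ n, 0 < δ n) → Tendsto δ atTop (𝓝 0) →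
      ∀ (V : ℕ → Finset (ℤ × ℤ)),
        (∀ n, ∀ v : ℤ × ℤ, v ∈ V n ↔
          ((v.1 : ℂ) * δ n + (v.2 : ℂ) * δ n * Complex.I) ∈ closure D.carrier) →
      ∀ (p : ℕ → Fin 4 → ℤ × ℤ), (∀ n, Function.Injective (p n)) →
        (∀ i, Tendsto (fun n ↦ ((p n i).1 : ℂ) * δ n + ((p n i).2 : ℂ) * δ n * Complex.I)
          atTop (𝓝 (D.pt i))) →
        (∀ n, CollarLegModel.LegInsertionData.IsAdmissible
          ⟨{p n 0, p n 1, p n 2}, fun v ↦ if v = p n 0 ∨ v = p n 1 ∨ v = p n 2 then 1 else 0, p n 3⟩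
          (V n)) →
        Tendsto (fun n ↦ (δ n)⁻¹ *
            ‖CollarLegModel.Zins (V n)
                ⟨{p n 0, p n 1, p n 2}, fun v ↦ if v = p n 0 ∨ v = p n 1 ∨ v = p n 2 then 1 else 0,
                  p n 3⟩‖ /
              ‖(CollarLegModel.ofDomain (V n)).Z‖)
          atTop
          (𝓝 (C * ((‖w (D.pt 0) - w (D.pt 1)‖ * ‖w (D.pt 0) - w (D.pt 2)‖ *
              ‖w (D.pt 1) - w (D.pt 2)‖) ^ (1 / 3 : ℝ) *
            (‖w (D.pt 0) - w (D.pt 3)‖ * ‖w (D.pt 1) - w (D.pt 3)‖ *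
              ‖w (D.pt 2) - w (D.pt 3)‖) ^ (-(2 / 3) : ℝ)) * ‖deriv w (D.pt 3)‖)) := by
  obtain ⟨C, hC, hmain⟩ := h 4 ![1, 1, 1, 3] 3 (by decide)
  refine ⟨C, hC, fun D hS hflat w U hU hDU hptU hw hbij hmono δ hδ hδ0 V hV p hp hpt hadm ↦ ?_⟩
  have hι := fun n ↦ insertionData_oneOneOneThree (hp n)
  have key := hmain D hS hflat w U hU hDU hptU hw hbij hmono δ hδ hδ0 V hV p hp hpt
    (fun n ↦ by rw [hι n]; exact hadm n)
  obtain ⟨-, hval⟩ := markDensity_bookkeeping C (δ 0) (fun i ↦ w (D.pt i)) (fun i ↦ deriv w (D.pt i))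
  rw [hval] at key
  refine key.congr fun n ↦ ?_
  obtain ⟨hexp, -⟩ := markDensity_bookkeeping C (δ n) (fun i ↦ w (D.pt i)) (fun i ↦ deriv w (D.pt i))
  rw [hexp, hι n]

end Summit.CriticalPhenomena.CardyFormulaZ2.Theorems

end
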